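import Summits.CriticalPhenomena.Ising3DConformalLimit.Theses.PrecisionLaplacian
import HarnessLib

/-!
# Route `PrecisionLaplacian` of `CriticalPhenomena/Ising3DConformalLimit` — assembly

Item `stmt-CriticalPhenomena-4806` (rank 1, assembly):
`InverseMFerromagnet → DirectCorrelationStableTail → StableConeRPRigidity → InverseMCriticalKernel →
CriticalCorrNineMirrorRP → TwoPointSpineGlue → MoebiusLimitOfTwoPointLaw →
IsingEuclidUpgradeR4NonGaussian → Ising3DConformalLimit`.

The proof is pure logic, exactly the route's glue: from IM, `InverseMCriticalKernel` gives the
symmetric-potential property of the critical kernel `G_A = (criticalTwoPoint 3 (q - p))_{p,q ∈ A}`;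
`DirectCorrelationStableTail` turns it into TAIL (asymptotic homogeneity of the direct correlation
function); `TwoPointSpineGlue` fed the potential property, TAIL, `StableConeRPRigidity` and
`CriticalCorrNineMirrorRP` yields the isotropic pure power law of the critical two-point function
(item 0634); `MoebiusLimitOfTwoPointLaw` produces `(ρ, Δ, S)` with a non-degenerate Möbius-covariant
pointwise scaling limit (item 1344); `IsingEuclidUpgradeR4NonGaussian` (item 0636) applied to
`(ρ, S)` gives `HasNontrivialU4 S`; the tuple is `Ising3DConformalLimit`
(root abbrev of `Literature.Probability.LatticeModels.CritIsing3DConformalLimit`).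

No mathematics beyond composition lives here; the content is in the cruxes
(`InverseMFerromagnet`, `DirectCorrelationStableTail`, `StableConeRPRigidity`,
`MoebiusLimitOfTwoPointLaw`, `IsingEuclidUpgradeR4NonGaussian`) and supports of the route.
-/

namespace Summit.CriticalPhenomena.Ising3DConformalLimit.Theorems

/-- Settles item `stmt-CriticalPhenomena-4806` (exact signature, the route decl
`Summit.CriticalPhenomena.Ising3DConformalLimit.Theses.PrecisionLaplacian.Assembly`):
`InverseMFerromagnet → DirectCorrelationStableTail → StableConeRPRigidity → InverseMCriticalKernel →
CriticalCorrNineMirrorRP → TwoPointSpineGlue → MoebiusLimitOfTwoPointLaw →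
IsingEuclidUpgradeR4NonGaussian → Ising3DConformalLimit`, by composing the hypotheses
(symmetric potential ⇒ TAIL ⇒ two-point power law ⇒ Möbius limit `(ρ, Δ, S)` ⇒ `U₄ ≢ 0`).
[folklore] -/
theorem PrecisionLaplacianAssembly_proof :
    Summit.CriticalPhenomena.Ising3DConformalLimit.Theses.PrecisionLaplacian.Assembly := by
  unfold Summit.CriticalPhenomena.Ising3DConformalLimit.Theses.PrecisionLaplacian.Assembly
  intro hIM hTailOf hIso hKer hRP hGlue hMoeb hNG
  -- symmetric-potential property of the critical kernel (IM ⇒ conclusion of InverseMCriticalKernel)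
  have hPot := hKer hIM
  -- TAIL: asymptotic homogeneity of the direct correlation function
  have hTail := hTailOf hPot
  -- two-point spine: isotropic pure power law of ⟨σ₀σ_x⟩ at β_c(3) (item 0634)
  have hLaw := hGlue hPot hTail hIso hRP
  -- Möbius-covariant non-degenerate pointwise scaling limit (item 1344)
  obtain ⟨ρ, Δ, S, hρ, hΔ, hlim, hnd, hmoeb⟩ := hMoeb hLaw
  -- clause (iii): non-Gaussianity of that limit (item 0636)
  exact ⟨ρ, Δ, S, hρ, hΔ, hlim, hnd, hmoeb, hNG ρ S hρ hlim hnd⟩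

end Summit.CriticalPhenomena.Ising3DConformalLimit.Theorems
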